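import Mathlib
import HarnessLib
import Summits.Ventures.LatticeQCDFlow.Scoring.SelfNormalisedErrorBarConsistency

/-!
# ASYMPTOTIC NORMALITY of the printed self-normalised reweighting estimate:
# `√n (Sₙ − E_p O) ⇒ N(0, σ²_SN)` in distribution, `σ²_SN = ∫ (p²/q)(O − E_p O)² dμ` the sandwich
# variance — Mathlib's central limit theorem for the centred scores plus Slutsky for the random
# denominator

HONEST FRAMING: exact (Metropolis-corrected) sampling algorithms for lattice gauge theory;
figures of merit are autocorrelation/cost numbers at stated couplings and volumes; no
continuum-physics claim.

Venture `LatticeQCDFlow` (cell pub-lqcd), topic `Scoring`; FANOUT row 4 (`s0-u1-b`, rung S0-B).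
Sequel of `Scoring/SelfNormalisedErrorBarConsistency` (imported: the printed squared standard error
satisfies `n·V̂ₙ → σ²_SN` almost surely) and `Scoring/SelfNormalisedReweightingConsistency`
(`Sₙ → E_p O`, `W̄ₙ → 1`).  Here the DISTRIBUTIONAL limit: along one independent proposal stream
`y₀, y₁, …` (laws `ν = q dμ`) with UNNORMALISED weights `w̃ = c·w`, `w = p/q`, the printed
estimate `Sₙ = Σ_{i<n} w̃ᵢO(yᵢ)/Σ_{i<n} w̃ᵢ` satisfies
`√n (Sₙ − a) ⇒ N(0, σ²_SN)`, `a = E_p O = ∫ p·O dμ`,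
`σ²_SN = E_q[w²(O − a)²] = ∫ (p²/q)(O − a)² dμ`, under the second-moment inputs of the error-bar file (`p²/q`, `(p²/q)O`, `(p²/q)O² ∈ L¹(μ)`,
`p·O ∈ L¹(μ)`).  Route: the centred scores `Zᵢ = w(yᵢ)(O(yᵢ) − a)` are i.i.d. with mean `0` and
variance `σ²_SN`, so Mathlib's central limit theorem
(`ProbabilityTheory.tendstoInDistribution_inv_sqrt_mul_sum_sub`) gives
`Tₙ = Σ_{i<n} Zᵢ/√n ⇒ N(0, σ²_SN)`; the mean weight `W̄ₙ → 1` almost surely, hence in probability;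
Slutsky (Mathlib's `TendstoInDistribution.continuous_comp_prodMk_of_tendstoInMeasure_const`, with
the continuous `g(x, w) = x / max(w, ½)`) gives `Tₙ/max(W̄ₙ, ½) ⇒ N(0, σ²_SN)`; and
`√n (Sₙ − a) = Tₙ/W̄ₙ = Tₙ/max(W̄ₙ, ½)` as soon as `W̄ₙ > ½`, i.e. eventually almost surely, so the
two sequences differ by one tending to `0` in probability
(`tendstoInDistribution_of_tendstoInMeasure_sub`).  With the error-bar file this says the printed
`±√V̂ₙ` is an asymptotically exact `68 %` radius (NOT a finite-`n` certificate — those are row 4's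
median-of-blocks files).  Printed counterparts NAMED ONLY (Geweke 1989 Thm 2; Owen 2013 §9.2,
Thm 9.2); nothing is cited as a fact; NEW WORK of the cell; no definition is introduced.

## Content (`ν = μ.withDensity q`; `w = p/q`; `a = ∫ p·O dμ`; `σ² = ∫ (p²/q)(O − a)² dμ`)

* the centred score under the model: `memLp_centredScore_model` (`w(O − a) ∈ L²(ν)`),
  `integral_centredScore_model` (`E_ν w(O − a) = E_p O − a`), `integral_sq_centredScore_model`
  (`E_ν (w(O − a))² = ∫ (p²/q)(O − a)² dμ`);
* `selfNorm_sub_eq_of_pos` (the algebra `√n(Sₙ − a) = Tₙ/max(W̄ₙ, ½)` when `W̄ₙ > ½`, any `c ≠ 0`);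
* **`selfNormReweighting_clt`** — for any real random variable `Y` (on any probability space) with
  law `gaussianReal 0 σ²`: `TendstoInDistribution (n ↦ √n (Sₙ − ∫ p·O dμ)) atTop Y`.

NOT CLAIMED: a Berry–Esseen rate; the studentised statement `(Sₙ − a)/√V̂ₙ ⇒ N(0, 1)` (one more
Slutsky step with the error-bar file; left for the next file); degenerate `σ² = 0` is INCLUDED
(Mathlib's CLT covers it, the limit being the Dirac mass `gaussianReal 0 0`); any number of ours.
-/

noncomputable section

namespace Summit.Ventures.LatticeQCDFlow.Scoring.CardConsistency

open MeasureTheory ProbabilityTheory Finset Real Filter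
open scoped Topology Function

/-! ## §1 The centred score `w·(O − a)` under the model law -/

section Model

variable {X : Type*} [MeasurableSpace X] {μ : Measure X} {p q O : X → ℝ}

/-- **`w(O − a) ∈ L²(q dμ)`** from `p²/q`, `(p²/q)O`, `(p²/q)O² ∈ L¹(μ)`
(`(w(O − a))²·q = (p²/q)(O² − 2aO + a²)`). [ours] -/
theorem memLp_centredScore_model (hpm : Measurable p) (hq0 : ∀ z, 0 < q z) (hqm : Measurable q)
    (hOm : Measurable O) (hM2i : Integrable (fun z => p z ^ 2 / q z) μ)
    (hT1i : Integrable (fun z => p z ^ 2 / q z * O z) μ)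
    (hT2i : Integrable (fun z => p z ^ 2 / q z * O z ^ 2) μ) (a : ℝ) :
    MemLp (fun x => p x / q x * (O x - a)) 2 (μ.withDensity fun z => ENNReal.ofReal (q z)) := by
  have hfm : Measurable fun x => p x / q x * (O x - a) := (hpm.div hqm).mul (hOm.sub_const a)
  rw [memLp_two_iff_integrable_sq hfm.aestronglyMeasurable,
    AllPairsVariance.integrable_withDensity_iff' (fun z => (hq0 z).le) hqm]
  have e : (fun x => (p x / q x * (O x - a)) ^ 2 * q x)
      = fun x => (p x ^ 2 / q x * O x ^ 2 - 2 * a * (p x ^ 2 / q x * O x))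
        + a ^ 2 * (p x ^ 2 / q x) := by
    funext x
    have hqx : q x ≠ 0 := (hq0 x).ne'
    field_simp
    ring
  rw [e]
  have h1 : Integrable (fun z => 2 * a * (p z ^ 2 / q z * O z)) μ := hT1i.const_mul _
  have h2 : Integrable (fun z => a ^ 2 * (p z ^ 2 / q z)) μ := hM2i.const_mul _
  have h3 : Integrable (fun z => p z ^ 2 / q z * O z ^ 2 - 2 * a * (p z ^ 2 / q z * O z)) μ :=
    hT2i.sub h1
  exact h3.add h2

/-- `E_ν w(O − a) = ∫ p·O dμ − a` (`∫ p = 1`). [ours] -/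
theorem integral_centredScore_model (hpi : Integrable p μ) (hp1 : ∫ z, p z ∂μ = 1)
    (hq0 : ∀ z, 0 < q z) (hqm : Measurable q) (hpO : Integrable (fun z => p z * O z) μ) (a : ℝ) :
    ∫ x, p x / q x * (O x - a) ∂(μ.withDensity fun z => ENNReal.ofReal (q z))
      = (∫ z, p z * O z ∂μ) - a := by
  rw [AllPairsVariance.integral_withDensity_eq' (fun z => (hq0 z).le) hqm]
  have e : (fun x => p x / q x * (O x - a) * q x) = fun x => p x * O x - a * p x := by
    funext x
    have hqx : q x ≠ 0 := (hq0 x).ne'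
    field_simp
  have h1 : Integrable (fun x => a * p x) μ := hpi.const_mul a
  rw [e, integral_sub hpO h1, integral_const_mul, hp1, mul_one]

/-- `E_ν (w(O − a))² = ∫ (p²/q)(O − a)² dμ = σ²_SN`. [ours] -/
theorem integral_sq_centredScore_model (hq0 : ∀ z, 0 < q z) (hqm : Measurable q) (a : ℝ) :
    ∫ x, (p x / q x * (O x - a)) ^ 2 ∂(μ.withDensity fun z => ENNReal.ofReal (q z))
      = ∫ z, p z ^ 2 / q z * (O z - a) ^ 2 ∂μ := by
  rw [AllPairsVariance.integral_withDensity_eq' (fun z => (hq0 z).le) hqm]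
  refine integral_congr_ae (Filter.Eventually.of_forall fun x => ?_)
  show (p x / q x * (O x - a)) ^ 2 * q x = p x ^ 2 / q x * (O x - a) ^ 2
  have hqx : q x ≠ 0 := (hq0 x).ne'
  field_simp

omit [MeasurableSpace X] in
/-- **The algebra behind Slutsky**: with normalised block sums `A = Σ wᵢOᵢ`, `B = Σ wᵢ`,
weights printed as `w̃ = c·w` (`c ≠ 0`), `n ≥ 1` and `B/n > ½`:
`√n·(Σ w̃ᵢOᵢ/Σ w̃ᵢ − a) = ((√n)⁻¹·Σ wᵢ(Oᵢ − a)) / max(B/n, ½)`. [ours] -/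
theorem selfNorm_sub_eq_of_pos {wt : X → ℝ} {c : ℝ} (hc : c ≠ 0)
    (hwt : ∀ z, wt z = c * (p z / q z)) (v : ℕ → X) (a : ℝ) {n : ℕ} (hn1 : 1 ≤ n)
    (hB : (1 : ℝ) / 2 < (∑ i ∈ range n, p (v i) / q (v i)) / n) :
    Real.sqrt n * ((∑ i ∈ range n, wt (v i) * O (v i)) / (∑ i ∈ range n, wt (v i)) - a)
      = ((Real.sqrt n)⁻¹ * ∑ i ∈ range n, p (v i) / q (v i) * (O (v i) - a))
          / max ((∑ i ∈ range n, p (v i) / q (v i)) / n) (1 / 2) := by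
  have hn0 : (0 : ℝ) < n := by exact_mod_cast hn1
  have hsq : 0 < Real.sqrt n := Real.sqrt_pos.2 hn0
  have hBpos : 0 < ∑ i ∈ range n, p (v i) / q (v i) := by
    have h : (0 : ℝ) < (∑ i ∈ range n, p (v i) / q (v i)) / n := by linarith
    exact (div_pos_iff_of_pos_right hn0).1 h
  have e1 : ∑ i ∈ range n, wt (v i) * O (v i) = c * ∑ i ∈ range n, p (v i) / q (v i) * O (v i) := by
    rw [Finset.mul_sum]
    exact Finset.sum_congr rfl fun i _ => by rw [hwt, mul_assoc]
  have e2 : ∑ i ∈ range n, wt (v i) = c * ∑ i ∈ range n, p (v i) / q (v i) := by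
    rw [Finset.mul_sum]
    exact Finset.sum_congr rfl fun i _ => hwt _
  have e3 : ∑ i ∈ range n, p (v i) / q (v i) * (O (v i) - a)
      = ∑ i ∈ range n, p (v i) / q (v i) * O (v i) - a * ∑ i ∈ range n, p (v i) / q (v i) := by
    rw [Finset.mul_sum, ← Finset.sum_sub_distrib]
    exact Finset.sum_congr rfl fun i _ => by ring
  have hnsq : Real.sqrt n ^ 2 = n := Real.sq_sqrt hn0.le
  rw [max_eq_left hB.le, e1, e2, e3, mul_div_mul_left _ _ hc]
  field_simp
  rw [hnsq]
  ring

end Model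

/-! ## §2 The central limit theorem for the printed estimate -/

section CLT

variable {Ω : Type*} [MeasurableSpace Ω] {P : Measure Ω} [IsProbabilityMeasure P]
variable {Ω' : Type*} [MeasurableSpace Ω'] {P' : Measure Ω'} [IsProbabilityMeasure P']
variable {X : Type*} [MeasurableSpace X] {μ : Measure X} {p q O : X → ℝ} {y : ℕ → Ω → X}
variable {Yg : Ω' → ℝ}

/-- **ASYMPTOTIC NORMALITY OF THE PRINTED SELF-NORMALISED ESTIMATE.**  One independent proposal
stream `yᵢ` (laws `μ.withDensity q`); `p` measurable, integrable, `∫ p dμ = 1`; `q > 0`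
measurable; `O` measurable with `p·O`, `p²/q`, `(p²/q)O`, `(p²/q)O² ∈ L¹(μ)`; weights printed with
ANY normalisation `w̃ = c·p/q`, `c ≠ 0`; `Y` any real random variable with law
`N(0, σ²)`, `σ² = ∫ (p²/q)(O − ∫ p·O dμ)² dμ`.  Then
`√n·(Σ_{i<n} w̃ᵢO(yᵢ)/Σ_{i<n} w̃ᵢ − ∫ p·O dμ) ⇒ Y` in distribution. [ours] -/
theorem selfNormReweighting_clt (hym : ∀ j, Measurable (y j)) (hind : iIndepFun y P)
    (hlaw : ∀ j, Measure.map (y j) P = μ.withDensity fun z => ENNReal.ofReal (q z))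
    (hpm : Measurable p) (hpi : Integrable p μ) (hp1 : ∫ z, p z ∂μ = 1) (hq0 : ∀ z, 0 < q z)
    (hqm : Measurable q) (hOm : Measurable O) (hpO : Integrable (fun z => p z * O z) μ)
    (hM2i : Integrable (fun z => p z ^ 2 / q z) μ)
    (hT1i : Integrable (fun z => p z ^ 2 / q z * O z) μ)
    (hT2i : Integrable (fun z => p z ^ 2 / q z * O z ^ 2) μ) {wt : X → ℝ} {c : ℝ} (hc : c ≠ 0)
    (hwt : ∀ z, wt z = c * (p z / q z))
    (hY : HasLaw Yg (gaussianReal 0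
      (∫ z, p z ^ 2 / q z * (O z - ∫ x, p x * O x ∂μ) ^ 2 ∂μ).toNNReal) P') :
    TendstoInDistribution (fun (n : ℕ) ω => Real.sqrt n *
        ((∑ i ∈ range n, wt (y i ω) * O (y i ω)) / (∑ i ∈ range n, wt (y i ω))
          - ∫ x, p x * O x ∂μ)) atTop Yg (fun _ => P) P' := by
  obtain ⟨a, ha⟩ : ∃ a : ℝ, a = ∫ x, p x * O x ∂μ := ⟨_, rfl⟩
  rw [← ha] at hY ⊢
  have hwtm : Measurable wt := by
    have h : wt = fun z => c * (p z / q z) := funext hwt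
    rw [h]
    exact (hpm.div hqm).const_mul c
  -- the centred score and its stream
  have hgm : Measurable fun x => p x / q x * (O x - a) := (hpm.div hqm).mul (hOm.sub_const a)
  have hg2 := memLp_centredScore_model (μ := μ) hpm hq0 hqm hOm hM2i hT1i hT2i a
  have hZ2 : MemLp (fun ω => p (y 0 ω) / q (y 0 ω) * (O (y 0 ω) - a)) 2 P := by
    have h : MemLp (fun x => p x / q x * (O x - a)) 2 (Measure.map (y 0) P) := by
      rw [hlaw]
      exact hg2
    exact h.comp_of_map (hym 0).aemeasurable
  have hZind : iIndepFun (fun k ω => p (y k ω) / q (y k ω) * (O (y k ω) - a)) P :=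
    hind.comp (fun _ => fun x => p x / q x * (O x - a)) fun _ => hgm
  have hZid : ∀ i, IdentDistrib (fun ω => p (y i ω) / q (y i ω) * (O (y i ω) - a))
      (fun ω => p (y 0 ω) / q (y 0 ω) * (O (y 0 ω) - a)) P P :=
    fun i => identDistrib_comp_stream hym hlaw (g := fun x => p x / q x * (O x - a)) hgm i
  have hZmean : ∫ ω, p (y 0 ω) / q (y 0 ω) * (O (y 0 ω) - a) ∂P = 0 := by
    rw [integral_comp_stream hym hlaw (g := fun x => p x / q x * (O x - a)) hgm 0,
      integral_centredScore_model hpi hp1 hq0 hqm hpO a, ← ha, sub_self]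
  have hZvar : Var[fun ω => p (y 0 ω) / q (y 0 ω) * (O (y 0 ω) - a); P]
      = ∫ z, p z ^ 2 / q z * (O z - a) ^ 2 ∂μ := by
    rw [variance_eq_sub hZ2]
    simp only [Pi.pow_apply]
    have hsqm : Measurable fun x => (p x / q x * (O x - a)) ^ 2 := hgm.pow_const 2
    rw [hZmean, integral_comp_stream hym hlaw (g := fun x => (p x / q x * (O x - a)) ^ 2) hsqm 0,
      integral_sq_centredScore_model hq0 hqm a]
    ring
  -- Mathlib's central limit theorem for the centred scores
  have hY' : HasLaw Yg (gaussianReal 0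
      (Var[fun ω => p (y 0 ω) / q (y 0 ω) * (O (y 0 ω) - a); P]).toNNReal) P' := by
    rw [hZvar]
    exact hY
  have hclt := tendstoInDistribution_inv_sqrt_mul_sum_sub (P := P) (P' := P')
    (X := fun k ω => p (y k ω) / q (y k ω) * (O (y k ω) - a)) hY' hZ2 hZind hZid
  simp only [hZmean, mul_zero, sub_zero] at hclt
  -- the mean weight tends to `1` in probability
  have hWm : ∀ n : ℕ, Measurable fun ω => (∑ i ∈ range n, p (y i ω) / q (y i ω)) / n := fun n =>
    (Finset.measurable_sum _ fun i _ => (hpm.div hqm).comp (hym i)).div_const _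
  have hWae := meanWeight_tendsto_one_ae hym hind hlaw hpm hpi hp1 hq0 hqm
  have hW : TendstoInMeasure P (fun (n : ℕ) ω => (∑ i ∈ range n, p (y i ω) / q (y i ω)) / n)
      atTop (fun _ => (1 : ℝ)) :=
    tendstoInMeasure_of_tendsto_ae (fun n => (hWm n).aestronglyMeasurable) hWae
  -- Slutsky with the continuous `g(x, w) = x / max(w, ½)`
  have hgc : Continuous fun z : ℝ × ℝ => z.1 / max z.2 (1 / 2) :=
    continuous_fst.div (continuous_snd.max continuous_const)
      fun z => (lt_max_of_lt_right (by norm_num : (0 : ℝ) < 1 / 2)).ne'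
  have hsl := hclt.continuous_comp_prodMk_of_tendstoInMeasure_const hgc hW
    (fun n => (hWm n).aemeasurable)
  have elim : (fun ω' => Yg ω' / max (1 : ℝ) (1 / 2)) = Yg := by
    funext ω'
    rw [max_eq_left (by norm_num), div_one]
  rw [elim] at hsl
  -- the printed statistic differs from the Slutsky statistic by a sequence that is eventually
  -- `0` almost surely, hence tends to `0` in probability
  have hXm : ∀ n : ℕ, Measurable fun ω => Real.sqrt n *
      ((∑ i ∈ range n, wt (y i ω) * O (y i ω)) / (∑ i ∈ range n, wt (y i ω)) - a) := fun n =>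
    (((Finset.measurable_sum _ fun i _ => (hwtm.comp (hym i)).mul (hOm.comp (hym i))).div
      (Finset.measurable_sum _ fun i _ => hwtm.comp (hym i))).sub_const a).const_mul _
  have hX'm : ∀ n : ℕ, Measurable fun ω =>
      ((Real.sqrt n)⁻¹ * ∑ k ∈ range n, p (y k ω) / q (y k ω) * (O (y k ω) - a))
        / max ((∑ i ∈ range n, p (y i ω) / q (y i ω)) / n) (1 / 2) := fun n =>
    ((Finset.measurable_sum _ fun k _ => hgm.comp (hym k)).const_mul _).div
      ((hWm n).max measurable_const)
  refine tendstoInDistribution_of_tendstoInMeasure_sub (μ'' := P) (μ' := P') _ Yg hsl ?_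
    (fun n => (hXm n).aemeasurable)
  refine tendstoInMeasure_of_tendsto_ae (fun n => ((hXm n).sub (hX'm n)).aestronglyMeasurable) ?_
  filter_upwards [hWae] with ω hWω
  have hpos : ∀ᶠ n : ℕ in atTop,
      (1 : ℝ) / 2 < (∑ i ∈ range n, p (y i ω) / q (y i ω)) / n :=
    hWω.eventually_const_lt (by norm_num)
  refine (tendsto_const_nhds (x := (0 : ℝ))).congr' ?_
  filter_upwards [hpos, eventually_ge_atTop 1] with n hn hn1
  rw [Pi.sub_apply, Pi.sub_apply, selfNorm_sub_eq_of_pos hc hwt (fun i => y i ω) a hn1 hn, sub_self]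

end CLT

end Summit.Ventures.LatticeQCDFlow.Scoring.CardConsistency

end
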